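import Literature.Analysis.FluidPDE.CheskidovForceIdentities
import Literature.Analysis.FluidPDE.CheskidovAssemblyTools
import HarnessLib

/-!
# Cheskidov's periodisation, IV: the limit forces and the convergence `f^{ν_m} → f`

Analysis/FluidPDE support file for the §6 periodisation step of Cheskidov, arXiv:2311.04182
(2023), Thm. 1.3, continuing `CheskidovForceIdentities`. For the family data `D : FamilyData`:

* the window limit drift force `Gw = η̃ • g + K^{mK}` (`mK` an index from which `K^m` is
  stationary) and its `1`-periodisation `Ginf`
  (`FamilyData.Gw`, `FamilyData.Ginf`): slices smooth, `1`-periodic, continuous in time with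
  values in `L²` (`FamilyData.Ginf_continuousInLpOn`, via the general
  `Torus.continuousInLpOn_timePeriodize`), and
  `sup_t ‖(∂ₜv₂ + (v₂·∇)v₂ - ν_mΔv₂)(t) - Ginf(t)‖_{L²} → 0` (`FamilyData.tendsto_nsBodyForce_v2_sub_Ginf`),
  fed by the `g_limit` clause of the family fact (`g^m → g` in `L^∞(ℝ; L²)`; the paper, p. 18,
  only states the goal "making sure that the resulting force converges in `L^∞(ℝ; L²)`");
* the window limit scalar force `Hw = χ • ρ̃` (the smooth realisation of
  `h = η' ρ̃ χ_{[1-τ/3,1-τ/4]}`, p. 18) and its periodisation `Hinf`: jointly smooth, `1`-periodic,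
  and `sup_t ‖h^m(t) - Hinf(t)‖_{L²} → 0` (`FamilyData.tendsto_adResidual_sub_Hinf`), using (4.5)
  before the blow-up time and `‖θ̃^m(1)‖ → 0` after it (Cheskidov 2023, §6, the two displays
  before "Now we can conclude").

## References

* A. Cheskidov, arXiv:2311.04182 (2023), §6, pp. 18–19.
-/

open MeasureTheory Set Filter Topology Function
open scoped ENNReal
open Literature.Analysis.FunctionSpaces (timePeriodize timeWrap timePeriodize_apply)

noncomputable section

namespace Literature.Analysis.FluidPDE

/-! ## Continuity in `L^p` of periodisations -/

namespace Torus

variable {d : Type*} [Fintype d]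
variable {F : Type*} [NormedAddCommGroup F]

/-- **`L^p`-continuity of a periodisation.** Let `W : ℝ → T^d → F` be continuous in time with
values in `L^p` on `ℝ`, and assume the seam condition `‖W(s) - W(a)‖_{L^p} → 0` as `s ↑ a + τ`
(the two ends of the window match in `L^p`). Then the `τ`-periodisation `timePeriodize a τ W` is
continuous in time with values in `L^p` on `ℝ` (inside the window it is a time translate of `W`;
at a seam the two one-sided limits agree). [folklore] -/
theorem continuousInLpOn_timePeriodize {p : ℝ≥0∞} {a τ : ℝ} (hτ : 0 < τ) {W : ℝ → UnitAddTorus d → F}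
    (hW : ContinuousInLpOn univ p W)
    (hend : Tendsto (fun s => eLpNorm (W s - W a) p volume) (𝓝[<] (a + τ)) (𝓝 0)) :
    ContinuousInLpOn univ p (timePeriodize a τ W) := by
  refine ⟨fun t _ => hW.1 _ (mem_univ _), fun t₀ _ => ?_⟩
  rw [nhdsWithin_univ]
  set n : ℤ := ⌊(t₀ - a) / τ⌋ with hn
  have hs₀ : timeWrap a τ t₀ = t₀ - n * τ := rfl
  have hmem := Literature.Analysis.FunctionSpaces.timeWrap_mem_Ico (a := a) hτ t₀
  -- continuity of `W` at the wrapped point, transported along the translation `t ↦ t - nτ`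
  have hcont : Tendsto (fun t => eLpNorm (W (t - n * τ) - W (t₀ - n * τ)) p volume) (𝓝 t₀) (𝓝 0) := by
    have h1 := hW.2 (t₀ - n * τ) (mem_univ _)
    rw [nhdsWithin_univ] at h1
    exact h1.comp ((continuous_id.sub continuous_const).tendsto t₀)
  rw [ENNReal.tendsto_nhds_zero]
  intro ε hε
  -- the left-seam smallness
  have hend' : ∀ᶠ s in 𝓝[<] (a + τ), eLpNorm (W s - W a) p volume ≤ ε :=
    (ENNReal.tendsto_nhds_zero.1 hend) ε hε
  obtain ⟨l, hl, hlsub⟩ := mem_nhdsLT_iff_exists_Ioo_subset.1 hend'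
  have hδ : 0 < a + τ - max l a := by
    have := mem_Iio.1 hl
    rcases le_total l a with h | h
    · rw [max_eq_right h]; linarith
    · rw [max_eq_left h]; linarith
  have hwrap := Literature.Analysis.FunctionSpaces.timeWrap_eventually_eq_or (a := a) hτ t₀ hδ
  have hct := (ENNReal.tendsto_nhds_zero.1 hcont) ε hε
  rcases eq_or_lt_of_le hmem.1 with heq | hlt
  · -- the base point sits on a seam: `W (wrap t₀) = W a`
    filter_upwards [hwrap, hct] with t ht hct
    rcases ht with h | ⟨h1, h2, h3⟩
    · rw [timePeriodize_apply, timePeriodize_apply, h, hs₀]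
      exact hct
    · rw [timePeriodize_apply, timePeriodize_apply, ← heq]
      refine hlsub ⟨?_, (Literature.Analysis.FunctionSpaces.timeWrap_mem_Ico hτ t).2⟩
      exact lt_of_le_of_lt (le_max_left l a) (by linarith)
  · -- the base point is inside the window: no seam is crossed near `t₀`
    have hpos : ∀ᶠ t in 𝓝 t₀, a < t - n * τ :=
      ((continuous_id.sub continuous_const).tendsto t₀).eventually (Ioi_mem_nhds hlt)
    filter_upwards [hwrap, hct, hpos] with t ht hct hpos
    rcases ht with h | ⟨h1, h2, h3⟩
    · rw [timePeriodize_apply, timePeriodize_apply, h, hs₀]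
      exact hct
    · exact absurd h3 (not_lt.2 hpos.le)

end Torus

namespace CheskidovPeriodic

/-- The flat two-torus (local notation). [folklore] -/
local notation "𝕋²" => UnitAddTorus (Fin 2)
/-- `ℝ²` (local notation). [folklore] -/
local notation "E²" => EuclideanSpace ℝ (Fin 2)

/-- A bound `derivEtaBound` for `|η'|` (chosen once). [folklore] -/
def derivEtaBound : ℝ := Classical.choose exists_abs_deriv_eta_le

/-- `0 ≤ derivEtaBound` and `|η' t| ≤ derivEtaBound`. [folklore] -/
theorem derivEtaBound_spec : 0 ≤ derivEtaBound ∧ ∀ t, |deriv eta t| ≤ derivEtaBound :=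
  Classical.choose_spec exists_abs_deriv_eta_le

namespace FamilyData

variable (D : FamilyData)

/-! ## The limit drift force -/

/-- An index from which on the correction `K^m` is stationary. [folklore] -/
def mK : ℕ := Classical.choose D.K_stationary

/-- `K^m = K^{mK}` for `m ≥ mK`. [folklore] -/
theorem K_eq_K_mK {m : ℕ} (hm : D.mK ≤ m) : D.K m = D.K D.mK :=
  Classical.choose_spec D.K_stationary m hm

/-- The window limit drift force `Gw = η̃ • g + K^{mK}` on `ℝ × T²` (Cheskidov 2023, §6: the limit
of the body forces of the periodised drifts, before periodisation). [cite: Cheskidov2023, §6 p. 18] -/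
def Gw (t : ℝ) (y : 𝕋²) : E² := etaTilde t • D.g t y + D.K D.mK t y

/-- The limit drift force `Ginf = ∑ₙ Gw(· + n)` (`1`-periodisation from the window `[2/5, 7/5)`). [cite: Cheskidov2023, §6 p. 18] -/
def Ginf : ℝ → 𝕋² → E² := timePeriodize (2 / 5) 1 D.Gw

/-- Slices of `Gw` are smooth. [folklore] -/
theorem Gw_smooth_slice (t : ℝ) : FunctionSpaces.Torus.IsSmooth (D.Gw t) :=
  ((D.g_smooth t).const_smul (etaTilde t)).add ((D.K_smooth D.mK).isSmooth_slice (mem_univ t))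

/-- Slices of `Ginf` are smooth. [folklore] -/
theorem Ginf_smooth_slice (t : ℝ) : FunctionSpaces.Torus.IsSmooth (D.Ginf t) := D.Gw_smooth_slice _

/-- `Ginf` is `1`-periodic. [folklore] -/
theorem Ginf_periodic : Periodic D.Ginf 1 :=
  Literature.Analysis.FunctionSpaces.periodic_timePeriodize one_pos _

/-- `Gw(2/5) = 0` (`η̃(2/5) = 0`, `K(2/5) = 0`). [folklore] -/
theorem Gw_two_fifths : D.Gw (2 / 5) = 0 := by
  funext y
  rw [Gw, etaTilde_of_le (by norm_num), zero_smul, zero_add, D.K_eq_zero_of_le _ (by norm_num)]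

/-- For `t > 1` the body forces `g^m(t)` vanish identically (the drifts vanish on the open set
`(1, ∞)`), hence the limit force is `L²`-null there: `‖g(t)‖_{L²} = 0`. [folklore] -/
theorem eLpNorm_g_eq_zero {t : ℝ} (ht : 1 < t) : eLpNorm (D.g t) 2 volume = 0 := by
  have hzero : ∀ m, Torus.nsBodyForce (D.ν m) (D.v m) t = 0 := fun m => by
    funext y
    have h0 : ∀ᶠ s in 𝓝 t, D.v m s = 0 := by
      filter_upwards [Ioi_mem_nhds ht] with s hs using D.v_eq_zero m s fun h => by linarith [h.2, mem_Ioi.1 hs]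
    have hd : FunctionSpaces.Torus.timeDerivWithin univ (D.v m) t y = 0 := by
      rw [FunctionSpaces.Torus.timeDerivWithin, derivWithin_univ]
      have heq : (fun s => D.v m s y) =ᶠ[𝓝 t] fun _ => (0 : E²) := h0.mono fun s hs => by simp [hs]
      rw [heq.deriv_eq, deriv_const]
    have hv : D.v m t = fun _ => (0 : E²) := by funext x; simp [h0.self_of_nhds]
    rw [Torus.nsBodyForce_apply, hd, hv, Pi.zero_apply]
    simp [FunctionSpaces.Torus.convect, FunctionSpaces.Torus.fderiv]
  have hle : ∀ m, eLpNorm (D.g t) 2 volume ≤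
      ⨆ s : ℝ, eLpNorm (Torus.nsBodyForce (D.ν m) (D.v m) s - D.g s) 2 volume := fun m => by
    calc eLpNorm (D.g t) 2 volume = eLpNorm (Torus.nsBodyForce (D.ν m) (D.v m) t - D.g t) 2 volume := by
          rw [hzero m, zero_sub, eLpNorm_neg]
      _ ≤ ⨆ s : ℝ, eLpNorm (Torus.nsBodyForce (D.ν m) (D.v m) s - D.g s) 2 volume :=
          le_iSup (fun s => eLpNorm (Torus.nsBodyForce (D.ν m) (D.v m) s - D.g s) 2 volume) t
  exact le_antisymm (ge_of_tendsto' D.g_limit hle) zero_le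

/-- `Gw` is continuous in time with values in `L²`. [folklore] -/
theorem Gw_continuousInLpOn : Torus.ContinuousInLpOn univ 2 D.Gw :=
  (Torus.ContinuousInLpOn.smul_continuousOn one_le_two D.g_cont (contDiff_etaTilde (n := 0)).continuous.continuousOn).add
    one_le_two ((D.K_smooth D.mK).continuousInLpOn 2)

/-- **`Ginf ∈ C(ℝ; L²)`**. [cite: Cheskidov2023, §6 p. 18] -/
theorem Ginf_continuousInLpOn : Torus.ContinuousInLpOn univ 2 D.Ginf := by
  refine Torus.continuousInLpOn_timePeriodize one_pos D.Gw_continuousInLpOn ?_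
  simp only [D.Gw_two_fifths, sub_zero]
  -- near `7/5` from the left, `Gw = g` has vanishing `L²` norm
  have h : ∀ᶠ s in 𝓝[<] ((2 / 5 : ℝ) + 1), eLpNorm (D.Gw s) 2 volume = 0 := by
    have hI : Ioo (1 : ℝ) (2 / 5 + 1) ∈ 𝓝[<] ((2 / 5 : ℝ) + 1) := Ioo_mem_nhdsLT (by norm_num)
    filter_upwards [hI] with s hs
    have hs23 : 2 / 3 ≤ s := by linarith [hs.1]
    have : D.Gw s = D.g s := by
      funext y; rw [Gw, etaTilde_of_ge hs23, one_smul, D.K_eq_zero_of_ge _ hs23, Pi.zero_apply, add_zero]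
    rw [this, D.eLpNorm_g_eq_zero hs.1]
  exact tendsto_const_nhds.congr' (h.mono fun s hs => hs.symm)

/-- **Convergence of the drift forces**: `sup_t ‖(∂ₜv₂^m + (v₂^m·∇)v₂^m - ν_mΔv₂^m)(t) - Ginf(t)‖_{L²} → 0`
(the paper, §6 p. 18, asks that "the resulting force converges in `L^∞(ℝ; L²)`"; the input is the
`g_limit` clause `g^m → g` of the family fact). For `m ≥ mK` the difference is the periodisation of
`η̃ • (g^m - g)`. [cite: Cheskidov2023, §6 p. 18] -/
theorem tendsto_nsBodyForce_v2_sub_Ginf :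
    Tendsto (fun m => ⨆ t : ℝ, eLpNorm (Torus.nsBodyForce (D.ν m) (D.v2 m) t - D.Ginf t) 2 volume)
      atTop (𝓝 0) := by
  refine tendsto_of_tendsto_of_tendsto_of_le_of_le' tendsto_const_nhds D.g_limit
    (Eventually.of_forall fun m => zero_le) ?_
  filter_upwards [eventually_ge_atTop D.mK] with m hm
  refine iSup_le fun t => ?_
  set s := timeWrap (2 / 5) 1 t
  have hdiff : Torus.nsBodyForce (D.ν m) (D.v2 m) t - D.Ginf t =
      etaTilde s • (Torus.nsBodyForce (D.ν m) (D.v m) s - D.g s) := by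
    funext y
    rw [Pi.sub_apply, D.nsBodyForce_v2, timePeriodize_apply, Ginf, timePeriodize_apply, Gw,
      D.K_eq_K_mK hm]
    simp only [Pi.smul_apply, Pi.sub_apply, smul_sub]
    abel
  rw [hdiff, eLpNorm_const_smul]
  have he : ‖etaTilde s‖ₑ ≤ 1 := by
    rw [← ofReal_norm, Real.norm_eq_abs, abs_of_nonneg (etaTilde_mem_Icc s).1]
    exact ENNReal.ofReal_le_one.2 (etaTilde_mem_Icc s).2
  calc ‖etaTilde s‖ₑ * eLpNorm (Torus.nsBodyForce (D.ν m) (D.v m) s - D.g s) 2 volume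
      ≤ 1 * eLpNorm (Torus.nsBodyForce (D.ν m) (D.v m) s - D.g s) 2 volume := by gcongr
    _ ≤ ⨆ r : ℝ, eLpNorm (Torus.nsBodyForce (D.ν m) (D.v m) r - D.g r) 2 volume := by
        rw [one_mul]
        exact le_iSup (fun r => eLpNorm (Torus.nsBodyForce (D.ν m) (D.v m) r - D.g r) 2 volume) s

/-! ## The limit scalar force -/

/-- The window limit scalar force `Hw(t) = χ(t) ρ̃(t)`, the smooth realisation of
`h = η'(t) ρ̃(t) χ_{[1-τ/3, 1-τ/4]}(t)` (Cheskidov 2023, §6, p. 18; `χ = η'` on the part of `supp η'`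
before the blow-up time and `χ = 0` from `t = 9/10` on). [cite: Cheskidov2023, §6 p. 18] -/
def Hw (t : ℝ) (y : 𝕋²) : ℝ := chi t • D.ρ t y

/-- The limit scalar force `Hinf = ∑ₙ Hw(· + n)` (the paper's `h = ∑_{n} η'(t-n) ρ̃(t-n) χ(t-n)`,
p. 18, written there with `n ∈ 2ℤ`, an evident slip for `τℤ`; here `τ = 1`). [cite: Cheskidov2023, §6 p. 18] -/
def Hinf : ℝ → 𝕋² → ℝ := timePeriodize (2 / 5) 1 D.Hw

/-- `Hw` is jointly smooth on `ℝ × T²` (`supp χ ⊂ (0,1)`, where `ρ̃` is smooth). [folklore] -/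
theorem Hw_smooth : FunctionSpaces.Torus.IsSmoothSpaceTimeOn univ D.Hw := by
  refine D.ρ_smooth.cutoff contDiff_chi ?_
  rw [interior_Ico]
  exact tsupport_chi_subset.trans (Icc_subset_Ioo (by norm_num) (by norm_num))

/-- `Hw(t) = 0` for `t ∉ (9/20, 33/25)`. [folklore] -/
theorem Hw_eq_zero {t : ℝ} (ht : t ∉ Ioo (9 / 20 : ℝ) (33 / 25)) : D.Hw t = 0 := by
  have hct : chi t = 0 := by
    by_contra h
    have := tsupport_chi_subset (subset_tsupport _ (mem_support.2 h))
    exact ht ⟨by linarith [this.1], by linarith [this.2]⟩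
  funext y
  rw [Hw, hct, zero_smul, Pi.zero_apply]

/-- `Hinf` is jointly smooth. [folklore] -/
theorem Hinf_smooth : FunctionSpaces.Torus.IsSmoothSpaceTimeOn univ D.Hinf :=
  D.Hw_smooth.timePeriodize one_pos (by norm_num) (by norm_num) fun _ ht => D.Hw_eq_zero ht

/-- `Hinf` is `1`-periodic. [folklore] -/
theorem Hinf_periodic : Periodic D.Hinf 1 :=
  Literature.Analysis.FunctionSpaces.periodic_timePeriodize one_pos _

/-- **Pointwise-in-time bound for the scalar forces before the blow-up time**: for `s ≤ 5/4`,
`‖η'(s)θ^m(s) - χ(s)ρ̃(s)‖_{L²} ≤ M sup_{t ∈ [0, 3/4]} ‖θ^m(t) - ρ̃(t)‖_{L²}` (`M = derivEtaBound`) (on `supp η' ∩ {s<1}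
⊂ (7/10, 3/4)` we have `χ = η'`; elsewhere both sides vanish). [cite: Cheskidov2023, §6 p. 18] -/
theorem eLpNorm_scalar_diff_le_early (m : ℕ) {s : ℝ} (hs : s ≤ 5 / 4) :
    eLpNorm (fun y => deriv eta s * D.θ m s y - D.Hw s y) 2 volume ≤
      ENNReal.ofReal derivEtaBound * ⨆ t ∈ Icc (0 : ℝ) (3 / 4), eLpNorm (D.θ m t - D.ρ t) 2 volume := by
  by_cases h : s ∈ Ioo (7 / 10 : ℝ) (3 / 4)
  · have hchi : chi s = deriv eta s := chi_of_le (by linarith [h.2])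
    have heq : (fun y => deriv eta s * D.θ m s y - D.Hw s y) = deriv eta s • (D.θ m s - D.ρ s) := by
      funext y; simp only [Hw, hchi, Pi.smul_apply, Pi.sub_apply, smul_eq_mul, mul_sub]
    rw [heq, eLpNorm_const_smul, ← ofReal_norm, Real.norm_eq_abs]
    exact mul_le_mul' (ENNReal.ofReal_le_ofReal (derivEtaBound_spec.2 s))
      (le_biSup (fun t => eLpNorm (D.θ m t - D.ρ t) 2 volume) ⟨by linarith [h.1], h.2.le⟩)
  · have hd : deriv eta s = 0 := by
      rcases le_or_gt s (7 / 10) with h1 | h1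
      · exact deriv_eta_eq_zero (Or.inr fun h' => by linarith [h'.1])
      · exact deriv_eta_eq_zero (Or.inl ⟨not_lt.1 fun h2 => h ⟨h1, h2⟩, hs⟩)
    have hc : chi s = 0 := by rw [chi, hd, zero_mul]
    have hz : (fun y => deriv eta s * D.θ m s y - D.Hw s y) = 0 := by
      funext y; simp [Hw, hd, hc]
    rw [hz, eLpNorm_zero]
    exact zero_le

/-- **Pointwise-in-time bound for the scalar forces after the blow-up time**: for
`s ∈ [5/4, 2]`, `‖η'(s)θ^m(s) - χ(s)ρ̃(s)‖_{L²} ≤ M ‖θ^m(1)‖_{L²}` (`χ = 0` there and the energy of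
`θ^m` decreases after `t = 1`; Cheskidov 2023, §6, "already on high modes, but small"). [cite: Cheskidov2023, §6 p. 18] -/
theorem eLpNorm_scalar_diff_le_late (m : ℕ) {s : ℝ} (hs : s ∈ Icc (5 / 4 : ℝ) 2) :
    eLpNorm (fun y => deriv eta s * D.θ m s y - D.Hw s y) 2 volume ≤
      ENNReal.ofReal derivEtaBound * ENNReal.ofReal (Real.sqrt (∫ y, D.θ m 1 y ^ 2)) := by
  have hc : chi s = 0 := chi_of_ge (by linarith [hs.1])
  have heq : (fun y => deriv eta s * D.θ m s y - D.Hw s y) = deriv eta s • D.θ m s := by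
    funext y; simp [Hw, hc]
  have hθs : FunctionSpaces.Torus.IsSmooth (D.θ m s) := (D.θ_smooth m).isSmooth_slice ⟨by linarith [hs.1], hs.2⟩
  rw [heq, eLpNorm_const_smul, ← ofReal_norm, Real.norm_eq_abs,
    eLpNorm_two_eq_ofReal_sqrt_integral_sq (hθs.memLp 2)]
  exact mul_le_mul' (ENNReal.ofReal_le_ofReal (derivEtaBound_spec.2 s))
    (ENNReal.ofReal_le_ofReal (Real.sqrt_le_sqrt (D.θ_sq_le_θ_one m ⟨by linarith [hs.1], hs.2⟩)))

/-- **Convergence of the scalar forces** (Cheskidov 2023, §6, `h^m → h` in `L^∞(ℝ; L²)`):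
`sup_t ‖h^m(t) - Hinf(t)‖_{L²} → 0`, where `h^m` is the advection–diffusion residual of
`(v₂^m, θ₂^m)` (the periodisation of `η' θ^m`, (6.7)). [cite: Cheskidov2023, §6 p. 18] -/
theorem tendsto_adResidual_sub_Hinf :
    Tendsto (fun m => ⨆ t : ℝ, eLpNorm (Torus.adResidual (D.ν m) (D.v2 m) (D.theta2 m) t - D.Hinf t) 2 volume)
      atTop (𝓝 0) := by
  -- the two bounds tend to zero
  have hE : Tendsto (fun m => ENNReal.ofReal derivEtaBound * ⨆ t ∈ Icc (0 : ℝ) (3 / 4), eLpNorm (D.θ m t - D.ρ t) 2 volume)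
      atTop (𝓝 0) := by
    have h := ENNReal.Tendsto.const_mul (D.θ_sub_ρ (3 / 4) ⟨by norm_num, by norm_num⟩)
      (a := ENNReal.ofReal derivEtaBound) (Or.inr ENNReal.ofReal_ne_top)
    rwa [mul_zero] at h
  have hL : Tendsto (fun m => ENNReal.ofReal derivEtaBound * ENNReal.ofReal (Real.sqrt (∫ y, D.θ m 1 y ^ 2)))
      atTop (𝓝 0) := by
    have h1 : Tendsto (fun m => Real.sqrt (∫ y, D.θ m 1 y ^ 2)) atTop (𝓝 0) := by
      have := (Real.continuous_sqrt.tendsto 0).comp D.θ_one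
      rwa [Function.comp_def, Real.sqrt_zero] at this
    have h2 : Tendsto (fun m => ENNReal.ofReal (Real.sqrt (∫ y, D.θ m 1 y ^ 2))) atTop (𝓝 0) := by
      have := (ENNReal.continuous_ofReal.tendsto 0).comp h1
      rwa [Function.comp_def, ENNReal.ofReal_zero] at this
    have h := ENNReal.Tendsto.const_mul h2 (a := ENNReal.ofReal derivEtaBound) (Or.inr ENNReal.ofReal_ne_top)
    rwa [mul_zero] at h
  have hsum := hE.add hL
  rw [add_zero] at hsum
  refine tendsto_of_tendsto_of_tendsto_of_le_of_le' tendsto_const_nhds hsum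
    (Eventually.of_forall fun m => zero_le) (Eventually.of_forall fun m => ?_)
  -- reduce the supremum over all times to the window
  have hper : (fun t => Torus.adResidual (D.ν m) (D.v2 m) (D.theta2 m) t - D.Hinf t) =
      timePeriodize (2 / 5) 1 (fun s => (fun y => deriv eta s * D.θ m s y - D.Hw s y)) := by
    funext t y
    rw [Pi.sub_apply, D.adResidual_v2_theta2, Hinf, timePeriodize_apply, timePeriodize_apply, timePeriodize_apply]
  rw [show (⨆ t : ℝ, eLpNorm (Torus.adResidual (D.ν m) (D.v2 m) (D.theta2 m) t - D.Hinf t) 2 volume) =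
      ⨆ t : ℝ, eLpNorm ((fun t => Torus.adResidual (D.ν m) (D.v2 m) (D.theta2 m) t - D.Hinf t) t) 2 volume
      from rfl, hper,
    Literature.Analysis.FunctionSpaces.iSup_comp_timePeriodize one_pos _ fun G => eLpNorm G 2 volume]
  refine iSup₂_le fun s hs => ?_
  rcases le_or_gt s (5 / 4) with h | h
  · exact (D.eLpNorm_scalar_diff_le_early m h).trans le_self_add
  · exact (D.eLpNorm_scalar_diff_le_late m ⟨h.le, by linarith [hs.2]⟩).trans le_add_self

end FamilyData

end CheskidovPeriodic

end Literature.Analysis.FluidPDE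

end
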